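import Mathlib.Topology.Homotopy.Lifting
import Mathlib.AlgebraicTopology.FundamentalGroupoid.Basic
import HarnessLib

/-!
# Coverings of a product `X × Y`: the slices over path-joined points of `Y` are isomorphic coverings of `X`

Topic `Literature/Topology/CoveringSpaces`. Let `p : E → X × Y` be a covering map (Mathlib
`IsCoveringMap`) and, for `y : Y`, let `E_y = {e | (p e).2 = y}` be the SLICE of `E` over
`X × {y}`, a space over `X` by `e ↦ (p e).1`. If `y₀` and `y₁` are joined by a path `δ` in `Y`,
then transport along the paths `t ↦ (x, δ t)` is a HOMEOMORPHISM `E_{y₀} ≃ₜ E_{y₁}` OVER `X`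
(`sliceHomeomorph`, `fst_apply_sliceHomeomorph`): it is the time-`1` map of the lift of the homotopy
`(t, e) ↦ ((p e).1, δ t)` starting at the inclusion `E_{y₀} ⊆ E` (homotopy lifting property of
covering maps, Hatcher Prop. 1.30, Mathlib `IsCoveringMap.liftHomotopy`), and its inverse is the
transport along `δ.symm` (the lift of `(x, δ · δ⁻¹) ≃ (x, refl)` ends where it starts: the monodromy
theorem, Mathlib `IsCoveringMap.monodromy`). Consequently the two slices have literally the same
loops over `X`: every loop in `E_{y₁}` at the transported base point is the transport of a loop in
`E_{y₀}` with the same projection to `X` (`exists_loop_slice_fst_eq`), so the images of their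
fundamental groups in `π₁(X)` coincide.

This is the topological half of the specialisation argument for finite étale covers ("a finite
étale cover of `S × B`, `B` connected, restricts to isomorphic covers of `S` over any two points of
`B`"), used to descend finite étale covers of `S ⊗_{ℚ̄} ℂ` to `ℚ̄` by spreading out over a
`ℚ̄`-variety `B` and specialising at a `ℚ̄`-point (the covering input of Voisin 2007, Prop. 0.7,
`HodgeTheory/HodgeGenericQbarDescent`), in place of SGA1 XIII Prop. 4.6.

Everything is proved; the only definitions are the transport maps themselves.

## References

* [HatcherAT2002] A. Hatcher, Algebraic Topology, CUP 2002, §1.3, Prop. 1.30 (homotopy lifting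
  property of covering spaces, p. 60) and the paragraph after it (path lifting, uniqueness; lifted
  homotopies of paths fix the end points), Prop. 1.31; §4.3, Prop. 4.61 (p. 405) and its proof:
  the transport `L_γ : F_{γ(0)} → F_{γ(1)}` along a path `γ` in the base of a fibration, obtained
  by lifting the homotopy `g_t(F_{γ(0)}) = γ(t)` from the inclusion `F_{γ(0)} ↪ E`, with
  `L_{γγ'} ≃ L_{γ'} L_γ` and inverse `L_{γ̄}` — here applied to the covering `E → X × Y → Y`
  fibrewise over `X`, where lifts are unique and `L_γ` is a homeomorphism.
-/

open Topology unitInterval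

namespace Literature.Topology.CoveringSpaces

variable {E X Y : Type*}

/-! ### The slices `E_y` of a map `p : E → X × Y` -/

section Slice

variable {p : E → X × Y}

/-- The **slice** of `p : E → X × Y` over `X × {y}`. [folklore] -/
def slice (p : E → X × Y) (y : Y) : Set E := {e | (p e).2 = y}

/-- Membership in the slice over `y`. [folklore] -/
theorem mem_slice_iff {y : Y} {e : E} : e ∈ slice p y ↔ (p e).2 = y := Iff.rfl

/-- A point of the slice over `y` lies over `((p e).1, y)`. [folklore] -/
theorem apply_eq_of_mem_slice {y : Y} {e : E} (he : e ∈ slice p y) : p e = ((p e).1, y) :=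
  Prod.ext rfl he

/-- A point of the slice over `y` lies in the fibre over `((p e).1, y)`. [folklore] -/
theorem mem_preimage_singleton_of_mem_slice {y : Y} {e : E} (he : e ∈ slice p y) :
    e ∈ p ⁻¹' {((p e).1, y)} :=
  apply_eq_of_mem_slice he

end Slice

variable [TopologicalSpace E] [TopologicalSpace X] [TopologicalSpace Y] {p : E → X × Y}

/-! ### The horizontal paths `t ↦ (x, δ t)` and the fibrewise monodromy along them -/

/-- The horizontal path `t ↦ (x, δ t)` in `X × Y` over a path `δ` in `Y`. [folklore] -/
def horizontalPath (x : X) {y₀ y₁ : Y} (δ : Path y₀ y₁) : Path (x, y₀) (x, y₁) :=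
  δ.map (f := fun y ↦ (x, y)) (continuous_const.prodMk continuous_id)

/-- The horizontal path at time `t` is `(x, δ t)` (by `rfl`). [folklore] -/
@[simp]
theorem horizontalPath_apply (x : X) {y₀ y₁ : Y} (δ : Path y₀ y₁) (t : I) :
    horizontalPath x δ t = (x, δ t) := rfl

/-- Reversing a horizontal path reverses the underlying path (Mathlib `Path.map_symm`). [folklore] -/
theorem horizontalPath_symm (x : X) {y₀ y₁ : Y} (δ : Path y₀ y₁) :
    (horizontalPath x δ).symm = horizontalPath x δ.symm :=
  Path.map_symm δ _

/-- Concatenation of horizontal paths (Mathlib `Path.map_trans`). [folklore] -/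
theorem horizontalPath_trans (x : X) {y₀ y₁ y₂ : Y} (δ : Path y₀ y₁) (δ' : Path y₁ y₂) :
    horizontalPath x (δ.trans δ') = (horizontalPath x δ).trans (horizontalPath x δ') :=
  Path.map_trans δ δ' _

/-- **Fibrewise monodromy along a horizontal path**: for a covering `p : E → X × Y`, transport of
the fibre over `(x, y₀)` to the fibre over `(x, y₁)` along `t ↦ (x, δ t)` (Mathlib
`IsCoveringMap.monodromy` of the homotopy class of the horizontal path).
[cite: HatcherAT2002, §1.3, Prop. 1.30 and the paragraph following it] -/
noncomputable def fibreTransport (cov : IsCoveringMap p) (x : X) {y₀ y₁ : Y} (δ : Path y₀ y₁) :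
    p ⁻¹' {(x, y₀)} → p ⁻¹' {(x, y₁)} :=
  cov.monodromy (Path.Homotopic.Quotient.mk (horizontalPath x δ))

/-- The fibrewise transport is the end point of the lifted horizontal path. [folklore] -/
theorem coe_fibreTransport (cov : IsCoveringMap p) (x : X) {y₀ y₁ : Y} (δ : Path y₀ y₁)
    (e : p ⁻¹' {(x, y₀)}) :
    (fibreTransport cov x δ e : E) =
      cov.liftPath (horizontalPath x δ) e ((horizontalPath x δ).source.trans e.2.symm) 1 :=
  rfl

/-- **Transport along `δ` and back is the identity**: `(x, δ · δ⁻¹)` is homotopic to the constant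
path, and monodromy only depends on the homotopy class (the monodromy theorem).
[cite: HatcherAT2002, §1.3 Prop. 1.30–1.31 and §4.3 Prop. 4.61 (proof: `L_{γ̄}` inverts `L_γ`)] -/
theorem fibreTransport_symm_apply (cov : IsCoveringMap p) (x : X) {y₀ y₁ : Y} (δ : Path y₀ y₁)
    (e : p ⁻¹' {(x, y₀)}) :
    fibreTransport cov x δ.symm (fibreTransport cov x δ e) = e := by
  unfold fibreTransport
  rw [← cov.monodromy_trans_apply, ← Path.Homotopic.Quotient.mk_trans, ← horizontalPath_symm,
    ← Path.Homotopic.Quotient.eq.2 ⟨.reflTransSymm _⟩, Path.Homotopic.Quotient.mk_refl,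
    cov.monodromy_refl]
  rfl

/-- The fibrewise transport is a bijection (its inverse is the transport along `δ.symm`).
[cite: HatcherAT2002, §1.3, Prop. 1.31] -/
theorem fibreTransport_bijective (cov : IsCoveringMap p) (x : X) {y₀ y₁ : Y} (δ : Path y₀ y₁) :
    Function.Bijective (fibreTransport cov x δ) :=
  cov.monodromy_bijective _

/-! ### The transport `E_{y₀} → E_{y₁}` of slices -/

/-- **Transport of the slice `E_{y₀}` to the slice `E_{y₁}` along a path `δ` from `y₀` to `y₁`**:
`e ↦` the end point of the lift starting at `e` of the horizontal path `t ↦ ((p e).1, δ t)`.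
[cite: HatcherAT2002, §4.3, Prop. 4.61 (proof: the map `L_γ = g̃₁`)] -/
noncomputable def sliceTransport (cov : IsCoveringMap p) {y₀ y₁ : Y} (δ : Path y₀ y₁) :
    slice p y₀ → slice p y₁ := fun e ↦
  ⟨fibreTransport cov (p e.1).1 δ ⟨e.1, mem_preimage_singleton_of_mem_slice e.2⟩,
    congrArg Prod.snd (fibreTransport cov (p e.1).1 δ ⟨e.1, _⟩).2⟩

/-- The slice transport is the fibrewise transport over the base point `(p e).1` (by `rfl`). [folklore] -/
theorem coe_sliceTransport (cov : IsCoveringMap p) {y₀ y₁ : Y} (δ : Path y₀ y₁) (e : slice p y₀) :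
    (sliceTransport cov δ e : E) =
      fibreTransport cov (p e.1).1 δ ⟨e.1, mem_preimage_singleton_of_mem_slice e.2⟩ :=
  rfl

/-- The transport commutes with the projection to `X`. [folklore] -/
@[simp]
theorem fst_apply_sliceTransport (cov : IsCoveringMap p) {y₀ y₁ : Y} (δ : Path y₀ y₁)
    (e : slice p y₀) : (p (sliceTransport cov δ e)).1 = (p e).1 := by
  have h : p (fibreTransport cov (p e.1).1 δ ⟨e.1, mem_preimage_singleton_of_mem_slice e.2⟩ : E) =
      ((p e.1).1, y₁) :=
    (fibreTransport cov (p e.1).1 δ ⟨e.1, _⟩).2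
  have h1 := congrArg Prod.fst h
  exact h1

/-- The fibrewise transport does not depend on how the base point `x` is presented. [folklore] -/
theorem coe_fibreTransport_congr (cov : IsCoveringMap p) {x x' : X} (h : x = x') {y₀ y₁ : Y}
    (δ : Path y₀ y₁) (e : E) (he : p e = (x, y₀)) (he' : p e = (x', y₀)) :
    (fibreTransport cov x' δ ⟨e, he'⟩ : E) = (fibreTransport cov x δ ⟨e, he⟩ : E) := by
  subst h
  rfl

/-- **Transport along `δ` and back along `δ.symm` is the identity on the slice.**
[cite: HatcherAT2002, §1.3 Prop. 1.30–1.31 and §4.3 Prop. 4.61 (proof)] -/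
theorem sliceTransport_symm_apply (cov : IsCoveringMap p) {y₀ y₁ : Y} (δ : Path y₀ y₁)
    (e : slice p y₀) : sliceTransport cov δ.symm (sliceTransport cov δ e) = e := by
  apply Subtype.ext
  rw [coe_sliceTransport]
  have hx : (p (sliceTransport cov δ e : E)).1 = (p e.1).1 := fst_apply_sliceTransport cov δ e
  have he : p (sliceTransport cov δ e : E) = ((p e.1).1, y₁) := by
    rw [apply_eq_of_mem_slice (sliceTransport cov δ e).2, hx]
  rw [coe_fibreTransport_congr cov hx.symm δ.symm (sliceTransport cov δ e : E) he
    (apply_eq_of_mem_slice (sliceTransport cov δ e).2)]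
  have harg : (⟨(sliceTransport cov δ e : E), he⟩ : p ⁻¹' {((p e.1).1, y₁)}) =
      fibreTransport cov (p e.1).1 δ ⟨e.1, mem_preimage_singleton_of_mem_slice e.2⟩ :=
    Subtype.ext rfl
  rw [harg]
  exact congrArg Subtype.val (fibreTransport_symm_apply cov (p e.1).1 δ
    ⟨e.1, mem_preimage_singleton_of_mem_slice e.2⟩)

/-- The homotopy `(t, e) ↦ ((p e).1, δ t)` from the projection of the slice `E_{y₀}`. [folklore] -/
noncomputable def sliceHomotopy (p : E → X × Y) (hp : Continuous p) {y₀ y₁ : Y} (δ : Path y₀ y₁) :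
    C(I × slice p y₀, X × Y) where
  toFun te := ((p te.2.1).1, δ te.1)
  continuous_toFun :=
    ((continuous_fst.comp (hp.comp (continuous_subtype_val.comp continuous_snd))).prodMk
      (δ.continuous.comp continuous_fst))

/-- **The slice transport is the time-`1` map of the lifted homotopy** `(t, e) ↦ ((p e).1, δ t)`
starting at the inclusion `E_{y₀} ⊆ E` (uniqueness of path lifting). [cite: HatcherAT2002, §1.3, Prop. 1.30] -/
theorem coe_sliceTransport_eq_liftHomotopy (cov : IsCoveringMap p) {y₀ y₁ : Y} (δ : Path y₀ y₁)
    (e : slice p y₀) :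
    (sliceTransport cov δ e : E) =
      cov.liftHomotopy (sliceHomotopy p cov.continuous δ) ⟨Subtype.val, continuous_subtype_val⟩
        (fun a ↦ by
          change ((p a.1).1, δ 0) = p a.1
          rw [δ.source, ← apply_eq_of_mem_slice a.2]) (1, e) := by
  rw [cov.liftHomotopy_apply, coe_sliceTransport, coe_fibreTransport]
  congr 1

/-- The slice transport is continuous (homotopy lifting property of covering maps).
[cite: HatcherAT2002, §1.3, Prop. 1.30] -/
theorem continuous_sliceTransport (cov : IsCoveringMap p) {y₀ y₁ : Y} (δ : Path y₀ y₁) :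
    Continuous (sliceTransport cov δ) := by
  refine Continuous.subtype_mk ?_ _
  have h : Continuous fun e : slice p y₀ ↦
      cov.liftHomotopy (sliceHomotopy p cov.continuous δ) ⟨Subtype.val, continuous_subtype_val⟩
        (fun a ↦ by
          change ((p a.1).1, δ 0) = p a.1
          rw [δ.source, ← apply_eq_of_mem_slice a.2]) (1, e) :=
    (ContinuousMap.continuous _).comp (continuous_const.prodMk continuous_id)
  exact h.congr fun e ↦ (coe_sliceTransport_eq_liftHomotopy cov δ e).symm

/-- **The slices over path-joined points are homeomorphic over `X`**: transport along `δ`, with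
inverse the transport along `δ.symm`. [cite: HatcherAT2002, §1.3 Prop. 1.30 and §4.3 Prop. 4.61 (proof: `L_γ`, inverse `L_{γ̄}`)] -/
noncomputable def sliceHomeomorph (cov : IsCoveringMap p) {y₀ y₁ : Y} (δ : Path y₀ y₁) :
    slice p y₀ ≃ₜ slice p y₁ where
  toFun := sliceTransport cov δ
  invFun := sliceTransport cov δ.symm
  left_inv e := sliceTransport_symm_apply cov δ e
  right_inv e := by simpa only [Path.symm_symm] using sliceTransport_symm_apply cov δ.symm e
  continuous_toFun := continuous_sliceTransport cov δ
  continuous_invFun := continuous_sliceTransport cov δ.symm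

/-- The slice homeomorphism is the transport along `δ` (by `rfl`). [folklore] -/
@[simp]
theorem sliceHomeomorph_apply (cov : IsCoveringMap p) {y₀ y₁ : Y} (δ : Path y₀ y₁)
    (e : slice p y₀) : sliceHomeomorph cov δ e = sliceTransport cov δ e := rfl

/-- The inverse of the slice homeomorphism is the transport along `δ.symm` (by `rfl`). [folklore] -/
@[simp]
theorem sliceHomeomorph_symm_apply (cov : IsCoveringMap p) {y₀ y₁ : Y} (δ : Path y₀ y₁)
    (e : slice p y₁) : (sliceHomeomorph cov δ).symm e = sliceTransport cov δ.symm e := rfl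

/-- The slice homeomorphism commutes with the projections to `X`. [folklore] -/
@[simp]
theorem fst_apply_sliceHomeomorph (cov : IsCoveringMap p) {y₀ y₁ : Y} (δ : Path y₀ y₁)
    (e : slice p y₀) : (p (sliceHomeomorph cov δ e)).1 = (p e).1 :=
  fst_apply_sliceTransport cov δ e

/-- **Existence form**: if `y₀, y₁` are joined by a path then there is a homeomorphism of the
slices `E_{y₀} ≃ₜ E_{y₁}` commuting with the projections to `X`; in particular any two slices of
a covering of `X × Y` over a path-connected `Y` are isomorphic coverings of `X`.
[cite: HatcherAT2002, §1.3 Prop. 1.30 and §4.3 Prop. 4.61] -/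
theorem exists_sliceHomeomorph_of_joinedIn (cov : IsCoveringMap p) {y₀ y₁ : Y}
    (h : JoinedIn Set.univ y₀ y₁) :
    ∃ Ψ : slice p y₀ ≃ₜ slice p y₁, ∀ e, (p (Ψ e)).1 = (p e).1 := by
  obtain ⟨δ, -⟩ := h
  exact ⟨sliceHomeomorph cov δ, fst_apply_sliceHomeomorph cov δ⟩

/-- Over a path-connected `Y`, any two slices of a covering of `X × Y` are homeomorphic over `X`.
[cite: HatcherAT2002, §1.3 Prop. 1.30 and §4.3 Prop. 4.61] -/
theorem exists_sliceHomeomorph [PathConnectedSpace Y] (cov : IsCoveringMap p) (y₀ y₁ : Y) :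
    ∃ Ψ : slice p y₀ ≃ₜ slice p y₁, ∀ e, (p (Ψ e)).1 = (p e).1 :=
  ⟨sliceHomeomorph cov (PathConnectedSpace.somePath y₀ y₁),
    fst_apply_sliceHomeomorph cov _⟩

/-! ### Loops: the two slices have the same loops over `X` -/

/-- **Every loop in the slice `E_{y₁}` at the transported base point is the transport of a loop
in `E_{y₀}` with the same projection to `X`** (apply the inverse homeomorphism, which commutes with
the projection). Hence the images in `π₁(X, x₀)` of the fundamental groups of the two slices (at
`e₀` and at its transport) coincide. [cite: HatcherAT2002, §1.3, Prop. 1.31] -/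
theorem exists_loop_slice_fst_eq (cov : IsCoveringMap p) {y₀ y₁ : Y} (δ : Path y₀ y₁)
    (e₀ : slice p y₀) (γ₁ : Path (sliceHomeomorph cov δ e₀) (sliceHomeomorph cov δ e₀)) :
    ∃ γ₀ : Path e₀ e₀, ∀ t, (p (γ₀ t : E)).1 = (p (γ₁ t : E)).1 := by
  refine ⟨(γ₁.map (sliceHomeomorph cov δ).symm.continuous).cast ?_ ?_, fun t ↦ ?_⟩
  · exact ((sliceHomeomorph cov δ).symm_apply_apply e₀).symm
  · exact ((sliceHomeomorph cov δ).symm_apply_apply e₀).symm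
  · change (p ((sliceHomeomorph cov δ).symm (γ₁ t) : E)).1 = (p (γ₁ t : E)).1
    rw [sliceHomeomorph_symm_apply, fst_apply_sliceTransport]

/-- The same statement with the loops pushed to `X`: the loop `t ↦ (p (γ₁ t)).1` at
`x₀ = (p e₀).1` coming from the slice `E_{y₁}` equals a loop coming from the slice `E_{y₀}`.
[cite: HatcherAT2002, §1.3, Prop. 1.31] -/
theorem exists_loop_slice_fst_comp_eq (cov : IsCoveringMap p) {y₀ y₁ : Y} (δ : Path y₀ y₁)
    (e₀ : slice p y₀) (γ₁ : Path (sliceHomeomorph cov δ e₀) (sliceHomeomorph cov δ e₀)) :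
    ∃ γ₀ : Path e₀ e₀,
      (fun t ↦ (p (γ₀ t : E)).1) = fun t ↦ (p (γ₁ t : E)).1 := by
  obtain ⟨γ₀, h⟩ := exists_loop_slice_fst_eq cov δ e₀ γ₁
  exact ⟨γ₀, funext h⟩

end Literature.Topology.CoveringSpaces
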